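import Summits.CriticalPhenomena.PercolationContinuityZ3.Theorems.PercNearOneGluingNoHeavyLowerTailSahiCombMixMixedFourPieces

/-!
# The comb (tensor-Bernstein) hierarchy for Sahi's `E_k`, LIII: the six singleton MIXED four-event cells at the comb level

Support file of the one-cut programme (crux `NoHeavyLowerTail`, stmt-CriticalPhenomena-4575; cell `prim-masterthm`, seat P3, gen 9;
`run/shared/lean/prim/prim-masterthm/prim-masterthm-p3/HIERARCHY.md` §17(i)).  For four events `U_0..U_3` of a finite cube ignoring `e` whose ∩-closed family is comb-positive
at every order, the top row `E_4(μ_p; ·)` of each canonical mixed singleton pattern is comb-positive at multidegree `4`: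
`combPos_four_OAPP` `(U_0∪[e], U_1∩[e], U_2, U_3)`, `combPos_four_OOAP` `(U_0∪[e], U_1∪[e], U_2∩[e], U_3)`, `combPos_four_OAAP` `(U_0∪[e], U_1∩[e], U_2∩[e], U_3)`,
`combPos_four_OAAA`, `combPos_four_OOAA`, `combPos_four_OOOA` (the last for ANY four events ignoring `e`).  Proof: the mixed cube↔coin transfer
`sahiE_orAndCoord_eq_coin`, the closed identities of `…SahiMixtureMixedFour`, and the pieces of `…SahiCombMixMixedFourPieces` (hereditary rows `E_3`, `Cov` off `e`, Venn
moments, the coordinate basis).  The dispatch over all selector pairs (= `CombFourSingletonMixedCells`) is the sequel `…SahiCombMixMixedFourSingle`.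
HONEST FRAMING: nothing here asserts (M⁺-k) or `C_k` for `k ≥ 3`. [this work]
-/

noncomputable section

open scoped Classical

namespace Summit.CriticalPhenomena.PercolationContinuityZ3.Theorems

open Finset Function
open Literature.Combinatorics.Sahi2008
open Literature.Probability.Percolation.DecisionTree (ind)
open SahiComb
open SahiCombHereditary (CombHereditary)

variable {ι : Type} [Fintype ι]

namespace SahiCombMix

section Cells

variable (U : Fin 4 → Set (Set ι)) (e : ι) (hUe : ∀ (j : Fin 4) (b : Bool), secAt e b (U j) = U j) (hU : CombHereditary U)
include hUe hU

/-- **OAPP** at the comb level. [this work] -/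
theorem combPos_four_OAPP :
    CombPos (fun _ : ι => 4) (fun p => sahiE (bernoulliWeight p) 4
      (fun j => ind (orAndCoord U e (![true, false, false, false] : Fin 4 → Bool) (![false, true, false, false] : Fin 4 → Bool) j))) := by
  have hE3 := cP_E3 U e hUe hU 1 2 3
  have c1 := (hE3.mono (deg_off_mono e (show 3 ≤ 4 by norm_num))).smul (by norm_num : (0:ℝ) ≤ 2)
  have c2 := ((((cP_const_sub U e hUe 0 le_rfl).mul_off e hE3 (show 1 + 3 ≤ 4 by norm_num)).add
      ((cP_cov U e hUe hU 1 2).mul_off e (combPos_diff' U e hUe 3 0) (show 2 + 1 ≤ 4 by norm_num))).add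
      ((cP_cov U e hUe hU 1 3).mul_off e (combPos_diff' U e hUe 2 0) (show 2 + 1 ≤ 4 by norm_num))).add
      ((((cP_mem U e hUe 1).mul_off e (cP_mem2_diff_first U e hUe 0 2 3) (show 1 + 1 ≤ 4 by norm_num))).smul (by norm_num : (0:ℝ) ≤ 2))
  have s1 := (SahiCombDisjunct.combPos_coord_pow e 1 0).mul_of_le c1 (deg4_single_add e 1 (by norm_num))
  have s2 := (SahiCombDisjunct.combPos_coord_pow e 1 1).mul_of_le c2 (deg4_single_add e 2 (by norm_num))
  have efam : (fun j => ind (orAndCoin (U j) ((![true, false, false, false] : Fin 4 → Bool) j) ((![false, true, false, false] : Fin 4 → Bool) j)))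
      = ![ind (orAndCoin (U 0) true false), ind (orAndCoin (U 1) false true), ind (orAndCoin (U 2) false false), ind (orAndCoin (U 3) false false)] := by
    funext j; fin_cases j <;> rfl
  refine (s1.add s2).congr fun p => ?_
  rw [sahiE_orAndCoord_eq_coin U e _ _ hUe p, efam, SahiMixture.sahiE_four_OAPP_eq (sum_bernoulliWeight p) (U 0) (U 1) (U 2) (U 3) (p e : ℝ)]
  ring

/-- **OOAP** at the comb level. [this work] -/
theorem combPos_four_OOAP :
    CombPos (fun _ : ι => 4) (fun p => sahiE (bernoulliWeight p) 4
      (fun j => ind (orAndCoord U e (![true, true, false, false] : Fin 4 → Bool) (![false, false, true, false] : Fin 4 → Bool) j))) := by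
  have hC := cP_cov U e hUe hU 2 3
  have c1 := (hC.mono (deg_off_mono e (show 2 ≤ 4 by norm_num))).smul (by norm_num : (0:ℝ) ≤ 2)
  -- `2 − μ(U0U1) − μU0 μU1 = (1 − μ(U0U1)) + (1 − μU0) + μU0 (1 − μU1)`
  have hN : CombPos (update (fun _ : ι => 2) e 0) (fun p => 2 - ex (bernoulliWeight p) (ind (U 0) * ind (U 1))
      - ex (bernoulliWeight p) (ind (U 0)) * ex (bernoulliWeight p) (ind (U 1))) :=
    ((((cP_one_sub_mem2 U e hUe 0 1).add (cP_const_sub U e hUe 0 le_rfl)).mono (deg_off_mono e (show 1 ≤ 2 by norm_num))).add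
      ((cP_mem U e hUe 0).mul_off e (cP_const_sub U e hUe 1 le_rfl) (show 1 + 1 ≤ 2 by norm_num))).congr fun p => by ring
  have c2 := ((((hC.mul_off e hN (show 2 + 2 ≤ 4 by norm_num)).add
      (((cP_mem U e hUe 2).mul_off e (cP_mem2_diff_mid U e hUe 0 1 3) (show 1 + 1 ≤ 3 by norm_num)).mul_off e
        (cP_const_sub U e hUe 1 le_rfl) (show 3 + 1 ≤ 4 by norm_num))).add
      (((cP_mem U e hUe 2).mul_off e (cP_mem2_diff_first U e hUe 0 1 3) (show 1 + 1 ≤ 3 by norm_num)).mul_off e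
        (cP_const_sub U e hUe 0 le_rfl) (show 3 + 1 ≤ 4 by norm_num))).add
      (((cP_mem U e hUe 2).mul_off e ((cP_mem U e hUe 0).add (cP_mem U e hUe 1)) (show 1 + 1 ≤ 3 by norm_num)).mul_off e
        (cP_mem_diff_mem3 U e hUe 0 1 3) (show 3 + 1 ≤ 4 by norm_num)))
  have c3 := ((((cP_const_sub U e hUe 0 le_rfl).mul_off e (cP_const_sub U e hUe 1 le_rfl) (show 1 + 1 ≤ 2 by norm_num)).mul_off e hC
      (show 2 + 2 ≤ 4 by norm_num)).add
      (((cP_mem U e hUe 2).mul_off e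
        (((cP_const_sub U e hUe 0 le_rfl).mul_off e (combPos_diff' U e hUe 3 1) (show 1 + 1 ≤ 2 by norm_num)).add
          ((cP_const_sub U e hUe 1 le_rfl).mul_off e (combPos_diff' U e hUe 3 0) (show 1 + 1 ≤ 2 by norm_num)))
        (show 1 + 2 ≤ 4 by norm_num))))
  have s1 := (SahiCombDisjunct.combPos_coord_pow e 1 0).mul_of_le c1 (deg4_single_add e 1 (by norm_num))
  have s2 := (SahiCombDisjunct.combPos_coord_pow e 1 1).mul_of_le c2 (deg4_single_add e 2 (by norm_num))
  have s3 := (combPos_coordBasis₃ e).mul_of_le c3 (deg4_single_add e 3 (by norm_num))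
  have efam : (fun j => ind (orAndCoin (U j) ((![true, true, false, false] : Fin 4 → Bool) j) ((![false, false, true, false] : Fin 4 → Bool) j)))
      = ![ind (orAndCoin (U 0) true false), ind (orAndCoin (U 1) true false), ind (orAndCoin (U 2) false true), ind (orAndCoin (U 3) false false)] := by
    funext j; fin_cases j <;> rfl
  refine ((s1.add s2).add s3).congr fun p => ?_
  rw [sahiE_orAndCoord_eq_coin U e _ _ hUe p, efam, SahiMixture.sahiE_four_OOAP_eq (sum_bernoulliWeight p) (U 0) (U 1) (U 2) (U 3) (p e : ℝ)]
  ring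

/-- **OAAP** at the comb level. [this work] -/
theorem combPos_four_OAAP :
    CombPos (fun _ : ι => 4) (fun p => sahiE (bernoulliWeight p) 4
      (fun j => ind (orAndCoord U e (![true, false, false, false] : Fin 4 → Bool) (![false, true, true, false] : Fin 4 → Bool) j))) := by
  have hE3 := cP_E3 U e hUe hU 1 2 3
  have hC13 := cP_cov U e hUe hU 1 3
  have hC23 := cP_cov U e hUe hU 2 3
  have c1 := (hE3.mono (deg_off_mono e (show 3 ≤ 4 by norm_num))).smul (by norm_num : (0:ℝ) ≤ 2)
  have hOnePlus : CombPos (update (fun _ : ι => 1) e 0) (fun p => 1 + ex (bernoulliWeight p) (ind (U 0))) :=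
    (combPos_const _ zero_le_one).add (cP_mem U e hUe 0)
  have hCovs : CombPos (update (fun _ : ι => 3) e 0) (fun p =>
      (ex (bernoulliWeight p) (ind (U 1) * ind (U 3)) - ex (bernoulliWeight p) (ind (U 1)) * ex (bernoulliWeight p) (ind (U 3))) * ex (bernoulliWeight p) (ind (U 2))
      + (ex (bernoulliWeight p) (ind (U 2) * ind (U 3)) - ex (bernoulliWeight p) (ind (U 2)) * ex (bernoulliWeight p) (ind (U 3))) * ex (bernoulliWeight p) (ind (U 1))) :=
    (hC13.mul_off e (cP_mem U e hUe 2) (show 2 + 1 ≤ 3 by norm_num)).add (hC23.mul_off e (cP_mem U e hUe 1) (show 2 + 1 ≤ 3 by norm_num))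
  have c2 := (((((cP_const_sub U e hUe 0 le_rfl).mul_off e hE3 (show 1 + 3 ≤ 4 by norm_num)).add
      ((cP_cov U e hUe hU 1 2).mul_off e (combPos_diff' U e hUe 3 0) (show 2 + 1 ≤ 4 by norm_num))).add
      (hOnePlus.mul_off e hCovs (show 1 + 3 ≤ 4 by norm_num))).add
      (((cP_mem U e hUe 1).mul_off e (cP_mem U e hUe 2) (show 1 + 1 ≤ 2 by norm_num)).mul_off e
        (((cP_mem2 U e hUe 0 3).mono (deg_off_mono e (show 1 ≤ 2 by norm_num))).add ((cP_mem U e hUe 0).mul_off e (cP_mem U e hUe 3) (show 1 + 1 ≤ 2 by norm_num))) (show 2 + 2 ≤ 4 by norm_num)))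
  have c3 := (((cP_const_sub U e hUe 0 le_rfl).mul_off e hCovs (show 1 + 3 ≤ 4 by norm_num)).add
      (((cP_mem U e hUe 1).mul_off e (cP_mem U e hUe 2) (show 1 + 1 ≤ 2 by norm_num)).mul_off e
        (((combPos_diff' U e hUe 3 0).mono (deg_off_mono e (show 1 ≤ 2 by norm_num))).add ((cP_mem U e hUe 3).mul_off e (cP_const_sub U e hUe 0 le_rfl) (show 1 + 1 ≤ 2 by norm_num)))
        (show 2 + 2 ≤ 4 by norm_num)))
  have s1 := (SahiCombDisjunct.combPos_coord_pow e 1 0).mul_of_le c1 (deg4_single_add e 1 (by norm_num))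
  have s2 := (SahiCombDisjunct.combPos_coord_pow e 1 1).mul_of_le c2 (deg4_single_add e 2 (by norm_num))
  have s3 := (combPos_coordBasis₃ e).mul_of_le c3 (deg4_single_add e 3 (by norm_num))
  have efam : (fun j => ind (orAndCoin (U j) ((![true, false, false, false] : Fin 4 → Bool) j) ((![false, true, true, false] : Fin 4 → Bool) j)))
      = ![ind (orAndCoin (U 0) true false), ind (orAndCoin (U 1) false true), ind (orAndCoin (U 2) false true), ind (orAndCoin (U 3) false false)] := by
    funext j; fin_cases j <;> rfl
  refine ((s1.add s2).add s3).congr fun p => ?_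
  rw [sahiE_orAndCoord_eq_coin U e _ _ hUe p, efam, SahiMixture.sahiE_four_OAAP_eq (sum_bernoulliWeight p) (U 0) (U 1) (U 2) (U 3) (p e : ℝ)]
  ring

/-- **OAAA** at the comb level. [this work] -/
theorem combPos_four_OAAA :
    CombPos (fun _ : ι => 4) (fun p => sahiE (bernoulliWeight p) 4
      (fun j => ind (orAndCoord U e (![true, false, false, false] : Fin 4 → Bool) (![false, true, true, true] : Fin 4 → Bool) j))) := by
  have hE3 := cP_E3 U e hUe hU 1 2 3
  have c1 := (hE3.mono (deg_off_mono e (show 3 ≤ 4 by norm_num))).smul (by norm_num : (0:ℝ) ≤ 2)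
  have hOnePlus : CombPos (update (fun _ : ι => 1) e 0) (fun p => 1 + ex (bernoulliWeight p) (ind (U 0))) :=
    (combPos_const _ zero_le_one).add (cP_mem U e hUe 0)
  have hCovs : CombPos (update (fun _ : ι => 3) e 0) (fun p =>
      (ex (bernoulliWeight p) (ind (U 1) * ind (U 2)) - ex (bernoulliWeight p) (ind (U 1)) * ex (bernoulliWeight p) (ind (U 2))) * ex (bernoulliWeight p) (ind (U 3))
      + (ex (bernoulliWeight p) (ind (U 1) * ind (U 3)) - ex (bernoulliWeight p) (ind (U 1)) * ex (bernoulliWeight p) (ind (U 3))) * ex (bernoulliWeight p) (ind (U 2))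
      + (ex (bernoulliWeight p) (ind (U 2) * ind (U 3)) - ex (bernoulliWeight p) (ind (U 2)) * ex (bernoulliWeight p) (ind (U 3))) * ex (bernoulliWeight p) (ind (U 1))) :=
    (((cP_cov U e hUe hU 1 2).mul_off e (cP_mem U e hUe 3) (show 2 + 1 ≤ 3 by norm_num)).add
      ((cP_cov U e hUe hU 1 3).mul_off e (cP_mem U e hUe 2) (show 2 + 1 ≤ 3 by norm_num))).add
      ((cP_cov U e hUe hU 2 3).mul_off e (cP_mem U e hUe 1) (show 2 + 1 ≤ 3 by norm_num))
  have h0123 := (((cP_mem U e hUe 0).mul_off e (cP_mem U e hUe 1) (show 1 + 1 ≤ 2 by norm_num)).mul_off e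
      (cP_mem U e hUe 2) (show 2 + 1 ≤ 3 by norm_num)).mul_off e (cP_mem U e hUe 3) (show 3 + 1 ≤ 4 by norm_num)
  have c2 := ((cP_const_sub U e hUe 0 le_rfl).mul_off e hE3 (show 1 + 3 ≤ 4 by norm_num)).add (hOnePlus.mul_off e hCovs (show 1 + 3 ≤ 4 by norm_num))
  have c3 := ((cP_const_sub U e hUe 0 le_rfl).mul_off e hCovs (show 1 + 3 ≤ 4 by norm_num)).add (h0123.smul (by norm_num : (0:ℝ) ≤ 2))
  have c4 := (((cP_mem U e hUe 1).mul_off e (cP_mem U e hUe 2) (show 1 + 1 ≤ 2 by norm_num)).mul_off e (cP_mem U e hUe 3)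
      (show 2 + 1 ≤ 3 by norm_num)).mul_off e (cP_const_sub U e hUe 0 le_rfl) (show 3 + 1 ≤ 4 by norm_num)
  have s1 := (SahiCombDisjunct.combPos_coord_pow e 1 0).mul_of_le c1 (deg4_single_add e 1 (by norm_num))
  have s2 := (SahiCombDisjunct.combPos_coord_pow e 1 1).mul_of_le c2 (deg4_single_add e 2 (by norm_num))
  have s3 := (combPos_coordBasis₃ e).mul_of_le c3 (deg4_single_add e 3 (by norm_num))
  have s4 := (combPos_coordBasis₄ e).mul_of_le c4 (deg4_single_add e 4 (by norm_num))
  have efam : (fun j => ind (orAndCoin (U j) ((![true, false, false, false] : Fin 4 → Bool) j) ((![false, true, true, true] : Fin 4 → Bool) j)))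
      = ![ind (orAndCoin (U 0) true false), ind (orAndCoin (U 1) false true), ind (orAndCoin (U 2) false true), ind (orAndCoin (U 3) false true)] := by
    funext j; fin_cases j <;> rfl
  refine (((s1.add s2).add s3).add s4).congr fun p => ?_
  rw [sahiE_orAndCoord_eq_coin U e _ _ hUe p, efam, SahiMixture.sahiE_four_OAAA_eq (sum_bernoulliWeight p) (U 0) (U 1) (U 2) (U 3) (p e : ℝ)]
  ring

/-- **OOAA** at the comb level. [this work] -/
theorem combPos_four_OOAA :
    CombPos (fun _ : ι => 4) (fun p => sahiE (bernoulliWeight p) 4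
      (fun j => ind (orAndCoord U e (![true, true, false, false] : Fin 4 → Bool) (![false, false, true, true] : Fin 4 → Bool) j))) := by
  have hC := cP_cov U e hUe hU 2 3
  have c1 := (hC.mono (deg_off_mono e (show 2 ≤ 4 by norm_num))).smul (by norm_num : (0:ℝ) ≤ 2)
  have hN : CombPos (update (fun _ : ι => 2) e 0) (fun p => 2 - ex (bernoulliWeight p) (ind (U 0) * ind (U 1))
      - ex (bernoulliWeight p) (ind (U 0)) * ex (bernoulliWeight p) (ind (U 1))) :=
    ((((cP_one_sub_mem2 U e hUe 0 1).add (cP_const_sub U e hUe 0 le_rfl)).mono (deg_off_mono e (show 1 ≤ 2 by norm_num))).add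
      ((cP_mem U e hUe 0).mul_off e (cP_const_sub U e hUe 1 le_rfl) (show 1 + 1 ≤ 2 by norm_num))).congr fun p => by ring
  have h23 := (cP_mem U e hUe 2).mul_off e (cP_mem U e hUe 3) (show 1 + 1 ≤ 2 by norm_num)
  have hM : CombPos (update (fun _ : ι => 2) e 0) (fun p => ex (bernoulliWeight p) (ind (U 0) * ind (U 1))
      + ex (bernoulliWeight p) (ind (U 0)) * ex (bernoulliWeight p) (ind (U 1))) :=
    ((cP_mem2 U e hUe 0 1).mono (deg_off_mono e (show 1 ≤ 2 by norm_num))).add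
      ((cP_mem U e hUe 0).mul_off e (cP_mem U e hUe 1) (show 1 + 1 ≤ 2 by norm_num))
  have h1m0 := cP_const_sub U e hUe 0 le_rfl
  have h1m1 := cP_const_sub U e hUe 1 le_rfl
  have hNN := h1m0.mul_off e h1m1 (show 1 + 1 ≤ 2 by norm_num)
  have hU01 : CombPos (update (fun _ : ι => 2) e 0) (fun p => ex (bernoulliWeight p) (ind (U 0)) + ex (bernoulliWeight p) (ind (U 1))
      - ex (bernoulliWeight p) (ind (U 0) * ind (U 1)) - ex (bernoulliWeight p) (ind (U 0)) * ex (bernoulliWeight p) (ind (U 1))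
      + ex (bernoulliWeight p) (ind (U 0)) * (1 - ex (bernoulliWeight p) (ind (U 1))) + ex (bernoulliWeight p) (ind (U 1)) * (1 - ex (bernoulliWeight p) (ind (U 0)))) :=
    (((((cP_mem U e hUe 0).mul_off e h1m1 (show 1 + 1 ≤ 2 by norm_num)).add ((combPos_diff' U e hUe 1 0).mono (deg_off_mono e (show 1 ≤ 2 by norm_num)))).add
      ((cP_mem U e hUe 0).mul_off e h1m1 (show 1 + 1 ≤ 2 by norm_num))).add
      ((cP_mem U e hUe 1).mul_off e h1m0 (show 1 + 1 ≤ 2 by norm_num))).congr fun p => by ring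
  have c2 := (hC.mul_off e hN (show 2 + 2 ≤ 4 by norm_num)).add (h23.mul_off e hM (show 2 + 2 ≤ 4 by norm_num))
  have c3 := (hC.mul_off e hNN (show 2 + 2 ≤ 4 by norm_num)).add (h23.mul_off e hU01 (show 2 + 2 ≤ 4 by norm_num))
  have c4 := h23.mul_off e hNN (show 2 + 2 ≤ 4 by norm_num)
  have s1 := (SahiCombDisjunct.combPos_coord_pow e 1 0).mul_of_le c1 (deg4_single_add e 1 (by norm_num))
  have s2 := (SahiCombDisjunct.combPos_coord_pow e 1 1).mul_of_le c2 (deg4_single_add e 2 (by norm_num))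
  have s3 := (combPos_coordBasis₃ e).mul_of_le c3 (deg4_single_add e 3 (by norm_num))
  have s4 := (combPos_coordBasis₄ e).mul_of_le c4 (deg4_single_add e 4 (by norm_num))
  have efam : (fun j => ind (orAndCoin (U j) ((![true, true, false, false] : Fin 4 → Bool) j) ((![false, false, true, true] : Fin 4 → Bool) j)))
      = ![ind (orAndCoin (U 0) true false), ind (orAndCoin (U 1) true false), ind (orAndCoin (U 2) false true), ind (orAndCoin (U 3) false true)] := by
    funext j; fin_cases j <;> rfl
  refine (((s1.add s2).add s3).add s4).congr fun p => ?_
  rw [sahiE_orAndCoord_eq_coin U e _ _ hUe p, efam, SahiMixture.sahiE_four_OOAA_eq (sum_bernoulliWeight p) (U 0) (U 1) (U 2) (U 3) (p e : ℝ)]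
  ring

omit hU in
/-- **OOOA** at the comb level — for ANY four events ignoring `e`. [this work] -/
theorem combPos_four_OOOA :
    CombPos (fun _ : ι => 4) (fun p => sahiE (bernoulliWeight p) 4
      (fun j => ind (orAndCoord U e (![true, true, true, false] : Fin 4 → Bool) (![false, false, false, true] : Fin 4 → Bool) j))) := by
  have h1m0 := cP_const_sub U e hUe 0 le_rfl
  have h1m1 := cP_const_sub U e hUe 1 le_rfl
  have h1m2 := cP_const_sub U e hUe 2 le_rfl
  have hd := cP_mem U e hUe 3
  have hB : CombPos (update (fun _ : ι => 3) e 0) (fun p =>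
      (ex (bernoulliWeight p) (ind (U 0) * ind (U 1)) - ex (bernoulliWeight p) (ind (U 0) * ind (U 1) * ind (U 2)))
      + (ex (bernoulliWeight p) (ind (U 0) * ind (U 2)) - ex (bernoulliWeight p) (ind (U 0) * ind (U 1) * ind (U 2)))
      + ex (bernoulliWeight p) (ind (U 1) * ind (U 2)) * (1 - ex (bernoulliWeight p) (ind (U 0)))
      + ex (bernoulliWeight p) (ind (U 2)) * (ex (bernoulliWeight p) (ind (U 0)) - ex (bernoulliWeight p) (ind (U 0) * ind (U 1)))
      + ex (bernoulliWeight p) (ind (U 1)) * (ex (bernoulliWeight p) (ind (U 2)) - ex (bernoulliWeight p) (ind (U 0) * ind (U 2)))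
      + ex (bernoulliWeight p) (ind (U 0)) * ex (bernoulliWeight p) (ind (U 1)) * (1 - ex (bernoulliWeight p) (ind (U 2)))) :=
    ((((((cP_mem2_diff_last U e hUe 0 1 2).add (cP_mem2_diff_mid U e hUe 0 1 2)).mono (deg_off_mono e (show 1 ≤ 3 by norm_num))).add
      (((cP_mem2 U e hUe 1 2).mul_off e h1m0 (show 1 + 1 ≤ 2 by norm_num)).mono (deg_off_mono e (show 2 ≤ 3 by norm_num)))).add
      (((cP_mem U e hUe 2).mul_off e (combPos_diff U e hUe 0 1) (show 1 + 1 ≤ 2 by norm_num)).mono (deg_off_mono e (show 2 ≤ 3 by norm_num)))).add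
      (((cP_mem U e hUe 1).mul_off e (combPos_diff' U e hUe 2 0) (show 1 + 1 ≤ 2 by norm_num)).mono (deg_off_mono e (show 2 ≤ 3 by norm_num)))).add
      (((cP_mem U e hUe 0).mul_off e (cP_mem U e hUe 1) (show 1 + 1 ≤ 2 by norm_num)).mul_off e h1m2 (show 2 + 1 ≤ 3 by norm_num))
  have hB3 : CombPos (update (fun _ : ι => 3) e 0) (fun p =>
      ex (bernoulliWeight p) (ind (U 0)) * (1 - ex (bernoulliWeight p) (ind (U 1))) * (1 - ex (bernoulliWeight p) (ind (U 2)))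
      + ex (bernoulliWeight p) (ind (U 1)) * (1 - ex (bernoulliWeight p) (ind (U 0))) * (1 - ex (bernoulliWeight p) (ind (U 2)))
      + ex (bernoulliWeight p) (ind (U 2)) * (1 - ex (bernoulliWeight p) (ind (U 0))) * (1 - ex (bernoulliWeight p) (ind (U 1)))
      + (ex (bernoulliWeight p) (ind (U 0)) - ex (bernoulliWeight p) (ind (U 0) * ind (U 1))) * (1 - ex (bernoulliWeight p) (ind (U 2)))
      + (ex (bernoulliWeight p) (ind (U 1)) - ex (bernoulliWeight p) (ind (U 1) * ind (U 2))) * (1 - ex (bernoulliWeight p) (ind (U 0)))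
      + (ex (bernoulliWeight p) (ind (U 2)) - ex (bernoulliWeight p) (ind (U 0) * ind (U 2))) * (1 - ex (bernoulliWeight p) (ind (U 1)))) :=
    ((((((((cP_mem U e hUe 0).mul_off e h1m1 (show 1 + 1 ≤ 2 by norm_num)).mul_off e h1m2 (show 2 + 1 ≤ 3 by norm_num)).add
      (((cP_mem U e hUe 1).mul_off e h1m0 (show 1 + 1 ≤ 2 by norm_num)).mul_off e h1m2 (show 2 + 1 ≤ 3 by norm_num))).add
      (((cP_mem U e hUe 2).mul_off e h1m0 (show 1 + 1 ≤ 2 by norm_num)).mul_off e h1m1 (show 2 + 1 ≤ 3 by norm_num))).add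
      (((combPos_diff U e hUe 0 1).mul_off e h1m2 (show 1 + 1 ≤ 2 by norm_num)).mono (deg_off_mono e (show 2 ≤ 3 by norm_num)))).add
      (((combPos_diff U e hUe 1 2).mul_off e h1m0 (show 1 + 1 ≤ 2 by norm_num)).mono (deg_off_mono e (show 2 ≤ 3 by norm_num)))).add
      (((combPos_diff' U e hUe 2 0).mul_off e h1m1 (show 1 + 1 ≤ 2 by norm_num)).mono (deg_off_mono e (show 2 ≤ 3 by norm_num))))
  have hB4 := (h1m0.mul_off e h1m1 (show 1 + 1 ≤ 2 by norm_num)).mul_off e h1m2 (show 2 + 1 ≤ 3 by norm_num)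
  have c2 := hd.mul_off e hB (show 1 + 3 ≤ 4 by norm_num)
  have c3 := hd.mul_off e hB3 (show 1 + 3 ≤ 4 by norm_num)
  have c4 := hd.mul_off e hB4 (show 1 + 3 ≤ 4 by norm_num)
  have s2 := (SahiCombDisjunct.combPos_coord_pow e 1 1).mul_of_le c2 (deg4_single_add e 2 (by norm_num))
  have s3 := (combPos_coordBasis₃ e).mul_of_le c3 (deg4_single_add e 3 (by norm_num))
  have s4 := (combPos_coordBasis₄ e).mul_of_le c4 (deg4_single_add e 4 (by norm_num))
  have efam : (fun j => ind (orAndCoin (U j) ((![true, true, true, false] : Fin 4 → Bool) j) ((![false, false, false, true] : Fin 4 → Bool) j)))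
      = ![ind (orAndCoin (U 0) true false), ind (orAndCoin (U 1) true false), ind (orAndCoin (U 2) true false), ind (orAndCoin (U 3) false true)] := by
    funext j; fin_cases j <;> rfl
  refine ((s2.add s3).add s4).congr fun p => ?_
  rw [sahiE_orAndCoord_eq_coin U e _ _ hUe p, efam, SahiMixture.sahiE_four_OOOA_eq (sum_bernoulliWeight p) (U 0) (U 1) (U 2) (U 3) (p e : ℝ)]
  ring

end Cells

end SahiCombMix

end Summit.CriticalPhenomena.PercolationContinuityZ3.Theorems

end
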